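import Summits.NavierStokesRegularity.NavierStokesRegularity.Theorems.StrainDoorsTypeIAncientUniformBounds
import Summits.NavierStokesRegularity.NavierStokesRegularity.Theorems.StrainDoorsSliceVorticityFloor
import HarnessLib

/-!
# Strain doors, PART M §M32(c′) — RIGIDITY IN `A_M`, MEASURE FORM: a slice whose vorticity superlevel set on a
# large ball has SMALL LEBESGUE MEASURE cannot be followed by a slice with definite `L³` mass

Helper lane of `stmt-NavierStokesRegularity-0056` (rung N0; NOTHING here is a claim about Navier–Stokes regularity —
a-priori rigidity inside the HYPOTHETICAL class `A_M` of KNSS-gauge Type-I ancient mild solutions).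

ROUND 71 closed door Y∞ (the `M`-only pointwise vorticity floor at sup-Type-I singular points) through the
POINTWISE rigidity `smallCurlSlice_forces_smallMass` (N12b, §M32(c)): `|curl U(−4q²)| ≤ η` on `B(0,ρ)` forces
`∫_{B̄(0,R_m√2)}|U(−2)|³ < γ`.  Door Y proper (Y_meas, ROUND-71 §4 / nsreg-p1 g39's ROUND 72: the superlevel-MEASURE
floor `μ(M)(T−t)^{3/2}`) needs the MEASURE form: smallness of the Lebesgue measure of the OPEN superlevel set
`{y ∈ B(0,ρ) : |curl U(−4q²)(y)| > η}` already forces the small mass.  With the class-uniform SPREADING DEVICE of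
`StrainDoorsTypeIAncientUniformBounds` (`typeIAncientMild_vorticityNumber_spread`: a point with vorticity number
`≥ 2η'` carries a whole parabolic ball of radius `r(M,η')√(−s)` with vorticity number `≥ η'`) this is immediate and
needs NO further compactness pass: if some `x ∈ B(0,ρ₀)` had `|curl U(−4q²)(x)| > η₀`, the ball `closedBall x (2qr)`
would lie inside `{|curl U(−4q²)| > η₀/4} ∩ B(0, ρ₀ + 2qr)`, whose measure is then at least
`|closedBall 0 (2qr)|` (translation invariance of Lebesgue measure) — so a measure `≤ |closedBall 0 (2qr)|/2`
forces N12b's pointwise hypothesis, hence the small mass.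

* ★★★ `smallSuperlevel_forces_smallMass M Rm hγ : ∃ q ≥ 1, ∃ ρ η μ > 0, ∀ U ∈ A_M,
  volume {y ∈ ball 0 ρ | η < |curl U(−4q²)(y)|} ≤ ofReal μ → ∫_{B̄(0,R_m√2)}|U(−2)|³ < γ` — `q` is N12b's
  `q(M,R_m,γ)`; the STRICT `η <` makes the set OPEN, which is what Fatou delivers for a pointwise limit of curls.
* ★★ `superlevel_measure_floor_of_mass` — contrapositive: definite mass at `−2` forces
  `ofReal μ < volume {y ∈ ball 0 ρ | η < |curl U(−4q²)(y)|}`.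

References: Koch–Nadirashvili–Seregin–Šverák, Acta Math. 203 (2009), Prop. 4.1, Lemma 3.1, Remark 6.1
(arXiv:0709.3599); Barker–Prange, Arch. Ration. Mech. Anal. 2020 (arXiv:1906.08225) §4–§5; Barker–Prange,
Comm. Math. Phys. 385 (2021) §1.3.
-/

noncomputable section

-- the summit and its single problem share the name `NavierStokesRegularity` (D-0017 nested layout)
set_option linter.dupNamespace false

open MeasureTheory Set Function Filter Metric Real
open _root_.Topology
open scoped ENNReal NNReal
open Literature.Analysis Literature.Analysis.FluidPDE

namespace Summit.NavierStokesRegularity.NavierStokesRegularity.Theorems.StrainDoors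

/-- ★★★ **RIGIDITY IN `A_M`, MEASURE FORM: A SMALL SUPERLEVEL MEASURE OF THE VORTICITY AT `−4q²` ON A LARGE BALL
FORCES SMALL `L³` MASS AT `−2`.**  For `M`, `R_m`, `γ > 0` there are `q = q(M,R_m,γ) ≥ 1` (the `q` of
`smallCurlSlice_forces_smallMass`) and `ρ, η, μ > 0` depending on `M, R_m, γ` only, such that every `U ∈ A_M` with
`volume {y ∈ B(0,ρ) : η < |curl U(−4q²)(y)|} ≤ μ` has `∫_{B̄(0,R_m√2)}|U(−2)|³ < γ`.  Proof: N12b's pointwise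
rigidity with `(q, ρ₀, η₀)`; the spreading device with vorticity number `4q²·η₀/2` and radius `r`;
`ρ = ρ₀ + 2qr`, `η = η₀/4`, `μ = |closedBall 0 (2qr)|/2`; a point of `B(0,ρ₀)` above `η₀` would put the ball
`closedBall x (2qr) ⊆ {η < |curl U(−4q²)|} ∩ B(0,ρ)`, of measure `|closedBall 0 (2qr)| > μ`.
[cite: KochNadirashviliSereginSverak2009, Prop. 4.1 (4.10), Lemma 3.1, Remark 6.1 (arXiv:0709.3599);
BarkerPrange2020Alignment, §4 Step 5 (arXiv:1906.08225 p. 17)] -/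
theorem smallSuperlevel_forces_smallMass (M Rm : ℝ) {γ : ℝ} (hγ : 0 < γ) :
    ∃ q : ℝ, 1 ≤ q ∧ ∃ ρ η μ : ℝ, 0 < ρ ∧ 0 < η ∧ 0 < μ ∧
      ∀ U : ℝ → EuclideanSpace ℝ (Fin 3) → EuclideanSpace ℝ (Fin 3), IsTypeIAncientMild M U →
        volume {y ∈ ball (0 : EuclideanSpace ℝ (Fin 3)) ρ | η < ‖curl (U (-(4 * q ^ 2))) y‖} ≤ ENNReal.ofReal μ →
        ∫ y in closedBall (0 : EuclideanSpace ℝ (Fin 3)) (Rm * Real.sqrt 2), ‖U (-2) y‖ ^ 3 < γ := by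
  obtain ⟨q, hq1, ρ₀, η₀, hρ₀, hη₀, hrig⟩ := smallCurlSlice_forces_smallMass M Rm hγ
  have hq0 : 0 < q := lt_of_lt_of_le one_pos hq1
  -- the spreading device for the vorticity number `4q² · (η₀/2)` (time `−4q²`, `(0 − s) = 4q²`, `√(−s) = 2q`)
  obtain ⟨r, hr, hspread⟩ :=
    typeIAncientMild_vorticityNumber_spread M (η := 4 * q ^ 2 * (η₀ / 2)) (by positivity)
  -- the measure of the spread ball
  obtain ⟨V, hVdef⟩ : ∃ V : ℝ≥0∞, V = volume (closedBall (0 : EuclideanSpace ℝ (Fin 3)) (r * (2 * q))) :=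
    ⟨_, rfl⟩
  have hV0 : 0 < V := by rw [hVdef]; exact measure_closedBall_pos volume _ (by positivity)
  have hVtop : V < ∞ := by rw [hVdef]; exact measure_closedBall_lt_top
  have hVreal : 0 < V.toReal := ENNReal.toReal_pos hV0.ne' hVtop.ne
  refine ⟨q, hq1, ρ₀ + r * (2 * q), η₀ / 4, V.toReal / 2, by positivity, by positivity, by positivity,
    fun U hU hμ => ?_⟩
  -- it suffices to check the pointwise hypothesis of N12b
  refine hrig U hU fun x hx => ?_
  by_contra hbig
  push Not at hbig
  have hσ : (-(4 * q ^ 2) : ℝ) < 0 := by nlinarith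
  have hsq : √(-(-(4 * q ^ 2))) = 2 * q := by
    rw [neg_neg, show (4 : ℝ) * q ^ 2 = (2 * q) ^ 2 by ring, Real.sqrt_sq (by positivity)]
  have h0σ : (0 : ℝ) - -(4 * q ^ 2) = 4 * q ^ 2 := by ring
  -- the spreading device at `x`
  have hx2 : 2 * (4 * q ^ 2 * (η₀ / 2)) ≤ (0 - -(4 * q ^ 2)) * ‖curl (U (-(4 * q ^ 2))) x‖ := by
    rw [h0σ]
    have := mul_le_mul_of_nonneg_left hbig.le (by positivity : (0 : ℝ) ≤ 4 * q ^ 2)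
    linarith
  have hball : closedBall x (r * (2 * q)) ⊆
      {y ∈ ball (0 : EuclideanSpace ℝ (Fin 3)) (ρ₀ + r * (2 * q)) | η₀ / 4 < ‖curl (U (-(4 * q ^ 2))) y‖} := by
    intro y hy
    have hy' : y ∈ closedBall x (r * √(-(-(4 * q ^ 2)))) := by rwa [hsq]
    have h1 := hspread hU _ hσ x hx2 y hy'
    rw [h0σ] at h1
    refine ⟨?_, ?_⟩
    · rw [mem_ball_zero_iff]
      have hxn : ‖x‖ < ρ₀ := mem_ball_zero_iff.1 hx
      have hyx : ‖y - x‖ ≤ r * (2 * q) := mem_closedBall_iff_norm.1 hy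
      calc ‖y‖ = ‖x + (y - x)‖ := by rw [add_sub_cancel]
        _ ≤ ‖x‖ + ‖y - x‖ := norm_add_le _ _
        _ < ρ₀ + r * (2 * q) := by linarith
    · show η₀ / 4 < ‖curl (U (-(4 * q ^ 2))) y‖
      have h2 : η₀ / 2 ≤ ‖curl (U (-(4 * q ^ 2))) y‖ :=
        le_of_mul_le_mul_left h1 (by positivity : (0 : ℝ) < 4 * q ^ 2)
      linarith
  -- the measure contradiction: `V = |closedBall x (2qr)| ≤ μ-set measure ≤ V/2`
  have hle : V ≤ ENNReal.ofReal (V.toReal / 2) :=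
    calc V = volume (closedBall x (r * (2 * q))) := by
          rw [hVdef, Measure.addHaar_closedBall_center volume x]
      _ ≤ volume {y ∈ ball (0 : EuclideanSpace ℝ (Fin 3)) (ρ₀ + r * (2 * q)) |
            η₀ / 4 < ‖curl (U (-(4 * q ^ 2))) y‖} := measure_mono hball
      _ ≤ ENNReal.ofReal (V.toReal / 2) := hμ
  have hreal : V.toReal ≤ V.toReal / 2 := by
    have h := ENNReal.toReal_mono ENNReal.ofReal_ne_top hle
    rwa [ENNReal.toReal_ofReal (by positivity)] at h
  linarith

/-- ★★ **Contrapositive: DEFINITE MASS AT `−2` FORCES A DEFINITE SUPERLEVEL MEASURE AT `−4q²`.**  With the same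
`M`-only constants: every `U ∈ A_M` with `∫_{B̄(0,R_m√2)}|U(−2)|³ ≥ γ` has
`volume {y ∈ B(0,ρ) : η < |curl U(−4q²)(y)|} > μ` — the class-level form of door Y_meas.
[cite: KochNadirashviliSereginSverak2009, Remark 6.1 (arXiv:0709.3599); BarkerPrange2020Alignment, §4 (arXiv:1906.08225)] -/
theorem superlevel_measure_floor_of_mass (M Rm : ℝ) {γ : ℝ} (hγ : 0 < γ) :
    ∃ q : ℝ, 1 ≤ q ∧ ∃ ρ η μ : ℝ, 0 < ρ ∧ 0 < η ∧ 0 < μ ∧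
      ∀ U : ℝ → EuclideanSpace ℝ (Fin 3) → EuclideanSpace ℝ (Fin 3), IsTypeIAncientMild M U →
        γ ≤ ∫ y in closedBall (0 : EuclideanSpace ℝ (Fin 3)) (Rm * Real.sqrt 2), ‖U (-2) y‖ ^ 3 →
        ENNReal.ofReal μ < volume {y ∈ ball (0 : EuclideanSpace ℝ (Fin 3)) ρ | η < ‖curl (U (-(4 * q ^ 2))) y‖} := by
  obtain ⟨q, hq1, ρ, η, μ, hρ, hη, hμ, h⟩ := smallSuperlevel_forces_smallMass M Rm hγ
  refine ⟨q, hq1, ρ, η, μ, hρ, hη, hμ, fun U hU hmass => ?_⟩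
  by_contra hle
  push Not at hle
  exact absurd (h U hU hle) (not_lt.2 hmass)

end Summit.NavierStokesRegularity.NavierStokesRegularity.Theorems.StrainDoors

end
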